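import Summits.AtomisticToContinuum.Crystallization.Theorems.ChartedZeroExcessLayeredLatticeLiouvilleUI

/-!
# Zero-excess layered lattice Liouville — part UJ (lens-2 g52, node «BondIsoThreading» I/III): the ᵇ-twins (M♭ᵇ)_ϑ `StrainSparseBPG` and
# [Cᵇ] `RigidCaccioppoliBPG` of line `_16XH19B(_tol)`, with the dictionary `(Mᵇ) ⟺ (M♭ᵇ)₀` (PROVED)

Part UI re-typed the leaves (R_W) ↦ (R_Wᵇ), (M) ↦ (Mᵇ) of statement 26636's column by ONE inserted hypothesis on the GIVEN registration, `IsBondIso S Ψ`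
(part TG) — the clause the column's producer (A0⁺ˣ) PROVES — after the same-chart ε-regularity pieces were found false AS TYPED on relatively faulted
equilibrium charts («ChartLamella», UI module docstring).  The pieces BENEATH (M) (parts UA–UD: [C], [C_T], [CC°], [CC°_W]; (M♭)_ϑ of part TZM; and, for a
uniform docket, [T] / [T_b] of parts UC / UG) carry the same refutable hypothesis.  Parts UJ, UK, UL file their ᵇ-TWINS — each the original VERBATIM
with `IsBondIso S Ψ →` (part TG) inserted right after the registration hypothesis `IsGlobalReg Cg η R S (LayeredHom L w) Ψ →`, conclusion unchanged —
and RE-PROVE every seam of the docket with the clause handed along (no seam USES the clause: it is threaded from the consumer's hypotheses to the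
producer's; the proofs are those of parts TZM, UB, UC, UD, UG with one more binder).  `X ⇒ Xᵇ` for every piece (PROVED), so no old docket is lost.
THIS PART: §ZJ.1 (M♭ᵇ)_ϑ `StrainSparseBPG` — `StrainSparseBPG.mono`, `(M♭)_ϑ ⇒ (M♭ᵇ)_ϑ`, `(Mᵇ) ⇒ (M♭ᵇ)_ϑ` (Chebyshev), `(M♭ᵇ)₀ ⇒ (Mᵇ)` (the sub-threshold
strain is free; `aHi ≤ 8/7`), `(Mᵇ) ⟺ (M♭ᵇ)₀`; §ZJ.2 [Cᵇ] `RigidCaccioppoliBPG` and `[C] ⇒ [Cᵇ]`.  PART UK: the Gehring glue `[Cᵇ] ∧ leaf ⇒ (M♭ᵇ)₀ ⇒ (Mᵇ)`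
and the tame-window side [Tᵇ] / [T_bᵇ]; PART UL: [C_Tᵇ], [CC°ᵇ], [CC°_Wᵇ] and the lines down to (Mᵇ).  DOCKET OF RECORD after UI–UL:
`(Mᵇ) ⟸ Gehring-leaf ∧ [I_D] ∧ [T_bᵇ] ∧ [KS] ∧ [W] ∧ [CC°_Wᵇ]` (one residual re-typed on each side, none added; literals `(aHi; Λ, θ, s; ϑ) =
(1; 2, 1/16, 1/50; tameRadius)` unchanged).  No `sorry`, no new axiom, no instance / notation; no literature claim beyond those of parts TZM, UA.
-/

noncomputable section

open scoped BigOperators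
open MeasureTheory Set Metric Filter Topology
open Summit.AtomisticToContinuum.Crystallization.Theorems.ChartedPlanarOrderRigidityDoor (E3 atomsIn)
open Summit.AtomisticToContinuum.Crystallization.Theorems.ChartedPlanarOrderDensityDichotomy (μS IsSep nK nK_nonneg)
open Summit.AtomisticToContinuum.Crystallization.Theorems.ChartedPlanarOrderCleanScaleP (IsCleanP IsDoorSetP)
open Summit.AtomisticToContinuum.Crystallization.Theorems.ChartedPlanarOrderMesoCut (LayeredHom EnvClose)
open Summit.AtomisticToContinuum.Crystallization.Theorems.ChartedPlanarOrderDoorLayered (atomsIn_subset)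
open Summit.AtomisticToContinuum.Crystallization.Theorems.ChartedPlanarOrderDoorLayeredOsc (IsTwoShellAffineGood)
open Literature.Analysis.PDE (finavg ZatorskaGoldstein2005_localGehringLemmaCounting)

namespace Summit.AtomisticToContinuum.Crystallization.Theorems.ChartedZeroExcessLayeredLatticeLiouville

/-! ### ZJ.1  (M♭ᵇ)_ϑ «StrainSparseBPG» and its dictionary with (Mᵇ) -/

/-- ★★ **(M♭ᵇ)_ϑ «StrainSparseBPG ϑ aHi Λ θ s»** — (M♭)_ϑ `StrainSparsePG` (part TZM) VERBATIM with the extra hypothesis `IsBondIso S Ψ` (part TG) on the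
GIVEN registration; conclusion unchanged (a re-registration `Ψ'` at `(Cg', η, R)` with tilt–strain data whose strain mass above every threshold `t₀ ≥ ϑ`,
`t₀ > 0`, is `≤ ε·η·nK(win R)`).  WEAKER than (M♭)_ϑ (`strainSparseBPG_of_strainSparsePG`); dictionary `(Mᵇ) ⟺ (M♭ᵇ)₀` PROVED below (part TZM's proofs).
For a bond-isomorphic `Ψ` the threshold family is the lens's dial on the PHYSICAL strain of `S`: `ϑ ≥ tameRadius` is the wild-bond regime of (R_Wᵇ),
`ϑ ∈ (0, tameRadius)` the sub-tame higher-integrability regime.  GENERIC · GSC-priced · UNDECIDED · TRUE-type expected.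
Why it might fail: as (Mᵇ) — hot spots of `O(1)` rigid misfit at density `≍ η` inside a bond-isomorphically registered near-flat fat window; NOT the
relatively faulted charts («ChartLamella»), which carry no bond-isomorphic registration.
Sources: part TZM ((M♭)_ϑ: Meyers 1963; Gehring, Acta Math. 130 (1973) 265; Giaquinta–Modica 1979; [giaquinta1984 Ch. V]); parts TG, UI. [this file, g52] -/
def StrainSparseBPG (ϑ aHi Λ θ s : ℝ) : Prop :=
  ∀ δ : ℝ, 0 < δ → ∀ a : ℝ, 0 < a → ∀ Cg : ℝ, 1 ≤ Cg → ∃ Cg' : ℝ, Cg ≤ Cg' ∧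
    ∀ t₀ : ℝ, ϑ ≤ t₀ → 0 < t₀ → ∀ ε : ℝ, 0 < ε → ∀ K₀ : ℝ, 0 < K₀ → ∃ η₁ : ℝ, 0 < η₁ ∧ ∃ R₁ : ℝ, 0 < R₁ ∧
      ∀ S : Set E3, IsDoorSetPG aHi δ S → (∀ q ∈ S, IsTwoShellAffineGood θ S q) →
        ∀ η : ℝ, 0 < η → η ≤ η₁ → ∀ R : ℝ, R₁ ≤ R →
          ∀ (L : E3 ≃L[ℝ] E3) (w : ℤ → E3), IsEquilChart a s Λ L w →
            ∀ Ψ : E3 → E3, IsGlobalReg Cg η R S (LayeredHom (L : E3 →L[ℝ] E3) w) Ψ → IsBondIso S Ψ →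
              K₀ ≤ η * nK (atomsIn (μS S) 0 R) →
                ∃ Ψ' : E3 → E3, IsGlobalReg Cg' η R S (LayeredHom (L : E3 →L[ℝ] E3) w) Ψ' ∧
                  ∃ (Q : E3 → (E3 ≃ₗᵢ[ℝ] E3)) (σ : E3 → ℝ), IsTiltStrainData S R Ψ' Q σ ∧
                    strainMassAbove t₀ (atomsIn (μS S) 0 R) σ ≤ ε * η * nK (atomsIn (μS S) 0 R)

/-- (M♭ᵇ)_ϑ is monotone in the threshold floor. [this file, g52] -/
theorem StrainSparseBPG.mono {ϑ ϑ' aHi Λ θ s : ℝ} (hϑ : ϑ ≤ ϑ') (h : StrainSparseBPG ϑ aHi Λ θ s) : StrainSparseBPG ϑ' aHi Λ θ s := by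
  intro δ hδ a ha Cg hCg
  obtain ⟨Cg', hCg', h'⟩ := h δ hδ a ha Cg hCg
  exact ⟨Cg', hCg', fun t₀ ht₀ ht₀' => h' t₀ (hϑ.trans ht₀) ht₀'⟩

/-- **(M♭)_ϑ ⇒ (M♭ᵇ)_ϑ (PROVED)** — one more hypothesis; nothing of part TZM's dictionary is lost. [this file, g52] -/
theorem strainSparseBPG_of_strainSparsePG {ϑ aHi Λ θ s : ℝ} (h : StrainSparsePG ϑ aHi Λ θ s) : StrainSparseBPG ϑ aHi Λ θ s := by
  intro δ hδ a ha Cg hCg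
  obtain ⟨Cg', hCg', h'⟩ := h δ hδ a ha Cg hCg
  refine ⟨Cg', hCg', fun t₀ ht₀ ht₀' ε hε K₀ hK₀ => ?_⟩
  obtain ⟨η₁, hη₁, R₁, hR₁, h''⟩ := h' t₀ ht₀ ht₀' ε hε K₀ hK₀
  exact ⟨η₁, hη₁, R₁, hR₁, fun S hS hg η hη hηle R hR L w hLw Ψ hΨ _ hfat => h'' S hS hg η hη hηle R hR L w hLw Ψ hΨ hfat⟩

/-- ★ **(Mᵇ) ⇒ (M♭ᵇ)_ϑ (PROVED, Chebyshev)** — part TZM's `strainSparsePG_of_strainNonConcentrationPG` with the clause handed along. [this file, g52] -/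
theorem strainSparseBPG_of_strainNonConcentrationBPG {aHi Λ θ s : ℝ} (h : StrainNonConcentrationBPG aHi Λ θ s) (ϑ : ℝ) :
    StrainSparseBPG ϑ aHi Λ θ s := by
  intro δ hδ a ha Cg hCg
  obtain ⟨Cg', hCg', h'⟩ := h δ hδ a ha Cg hCg
  refine ⟨Cg', hCg', fun t₀ _ ht₀ ε hε K₀ hK₀ => ?_⟩
  obtain ⟨η₁, hη₁, R₁, hR₁, h''⟩ := h' (t₀ * ε) (mul_pos ht₀ hε) K₀ hK₀
  refine ⟨η₁, hη₁, R₁, hR₁, fun S hS hgood η hη hηη₁ R hR L w hLw Ψ hΨ hB hfat => ?_⟩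
  obtain ⟨Ψ', hΨ', Q, σ, hdata, hsum⟩ := h'' S hS hgood η hη hηη₁ R hR L w hLw Ψ hΨ hB hfat
  refine ⟨Ψ', hΨ', Q, σ, hdata, ?_⟩
  have hfin : (atomsIn (μS S) 0 R).Finite := finite_atomsIn hδ hS.1.2.1 R
  have hσ0 := hdata.2.1
  have hpt : ∀ x ∈ atomsIn (μS S) 0 R, (if t₀ ≤ σ x then σ x ^ 2 else 0) ≤ t₀⁻¹ * σ x ^ 3 := by
    intro x _
    have hx0 : 0 ≤ σ x := hσ0 x
    split_ifs with ht
    · rw [le_inv_mul_iff₀ ht₀]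
      calc t₀ * σ x ^ 2 ≤ σ x * σ x ^ 2 := mul_le_mul_of_nonneg_right ht (sq_nonneg _)
        _ = σ x ^ 3 := by ring
    · positivity
  calc strainMassAbove t₀ (atomsIn (μS S) 0 R) σ ≤ ∑ᶠ x ∈ atomsIn (μS S) 0 R, t₀⁻¹ * σ x ^ 3 := winsum_le_winsum_of_le hfin hpt
    _ = t₀⁻¹ * ∑ᶠ x ∈ atomsIn (μS S) 0 R, σ x ^ 3 := winsum_const_mul hfin _ _
    _ ≤ t₀⁻¹ * (t₀ * ε * η * nK (atomsIn (μS S) 0 R)) := mul_le_mul_of_nonneg_left hsum (inv_nonneg.2 ht₀.le)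
    _ = ε * η * nK (atomsIn (μS S) 0 R) := by field_simp

/-- ★★ **(M♭ᵇ)₀ ⇒ (Mᵇ) (PROVED; `aHi ≤ 8/7`)** — the sub-threshold strain is free: part TZM's `strainNonConcentrationPG_of_strainSparsePG` VERBATIM (merge the
data with the identity data of the re-registration's profile at scale `R + 4`, truncate at `12`; `t₀ := ε/(8c²Cg')`, `ε♭ := ε/24`), the clause handed along.
[this file, g52] -/
theorem strainNonConcentrationBPG_of_strainSparseBPG {aHi Λ θ s : ℝ} (haHi : aHi ≤ 8 / 7) (h : StrainSparseBPG 0 aHi Λ θ s) :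
    StrainNonConcentrationBPG aHi Λ θ s := by
  intro δ hδ a ha Cg hCg
  obtain ⟨Cg', hCg', h'⟩ := h δ hδ a ha Cg hCg
  refine ⟨Cg', hCg', fun ε hε K₀ hK₀ => ?_⟩
  have hCg'0 : 0 < Cg' := by linarith
  have hc1 : 1 ≤ winDensC δ := one_le_winDensC hδ
  have hc2 : 1 ≤ winDensC δ ^ 2 := one_le_pow₀ hc1
  set t₀ : ℝ := ε / (8 * winDensC δ ^ 2 * Cg') with ht₀def
  have ht₀ : 0 < t₀ := by positivity
  obtain ⟨η₁, hη₁, R₁, hR₁, h''⟩ := h' t₀ ht₀.le ht₀ (ε / 24) (by positivity) K₀ hK₀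
  refine ⟨η₁, hη₁, max R₁ 12, lt_max_of_lt_left hR₁, fun S hS hgood η hη hηη₁ R hR L w hLw Ψ hΨ hB hfat => ?_⟩
  have hR₁R : R₁ ≤ R := (le_max_left _ _).trans hR
  have hR12 : 12 ≤ R := (le_max_right _ _).trans hR
  obtain ⟨Ψ', hΨ', Q, σ, hdata, hmass⟩ := h'' S hS hgood η hη hηη₁ R hR₁R L w hLw Ψ hΨ hB hfat
  refine ⟨Ψ', hΨ', ?_⟩
  obtain ⟨hdet, hσ0, hdomQ⟩ := hdata
  have htear := hΨ'.2.1
  -- the registration profile of `Ψ'` at scale `R + 4`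
  obtain ⟨τ, -, -, henv, hdom, hgrad, -⟩ := hΨ'.2.2.2 (R + 4) (by linarith)
  set W := atomsIn (μS S) 0 R with hWdef
  set W4 := atomsIn (μS S) 0 (R + 4) with hW4def
  have hWS : W ⊆ S := atomsIn_subset S R
  have hWfin : W.Finite := finite_atomsIn hδ hS.1.2.1 R
  have hW4fin : W4.Finite := finite_atomsIn hδ hS.1.2.1 (R + 4)
  have hWW4 : W ⊆ W4 := atomsIn_mono_radius (by linarith)
  -- merged and truncated data
  set τp : E3 → ℝ := fun x => max (τ x) 0 with hτpdef
  set Q' : E3 → (E3 ≃ₗᵢ[ℝ] E3) := fun x => if σ x ≤ τp x then Q x else LinearIsometryEquiv.refl ℝ E3 with hQ'def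
  set σ' : E3 → ℝ := fun x => min (min (σ x) (τp x)) 12 with hσ'def
  have hτp0 : ∀ x, 0 ≤ τp x := fun x => le_max_right _ _
  have hσ'0 : ∀ x, 0 ≤ σ' x := fun x => le_min (le_min (hσ0 x) (hτp0 x)) (by norm_num)
  have hσ'σ : ∀ x, σ' x ≤ σ x := fun x => (min_le_left _ _).trans (min_le_left _ _)
  have hσ'τ : ∀ x, σ' x ≤ τp x := fun x => (min_le_left _ _).trans (min_le_right _ _)
  have hσ'12 : ∀ x, σ' x ≤ 12 := fun x => min_le_right _ _
  refine ⟨Q', σ', ⟨fun x => ?_, hσ'0, fun x hx p hp hpx => ?_⟩, ?_⟩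
  · -- determinant `1`
    by_cases hc : σ x ≤ τp x
    · simp only [hQ'def, if_pos hc]; exact hdet x
    · simp only [hQ'def, if_neg hc]; exact det_refl_E3_eq_one
  · -- domination
    have hxS : x ∈ S := hWS hx
    have h12 : dist ((Q' x) (p - x)) (Ψ' p - Ψ' x) ≤ 12 := dist_rot_bond_le_twelve htear (Q' x) hxS hp hpx
    have hx4 : x ∈ W4 := hWW4 hx
    have hp4 : p ∈ W4 := mem_atomsIn_add_four hx hp hpx
    have hidτ : dist (p - x) (Ψ' p - Ψ' x) ≤ τp x := (hdom x hx4 p hp4 hpx).trans (le_max_left _ _)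
    refine le_min (le_min ?_ ?_) h12
    · by_cases hc : σ x ≤ τp x
      · simp only [hQ'def, if_pos hc]; exact hdomQ x hx p hp hpx
      · simp only [hQ'def, if_neg hc, LinearIsometryEquiv.coe_refl, id_eq]
        exact hidτ.trans (not_le.1 hc).le
    · by_cases hc : σ x ≤ τp x
      · simp only [hQ'def, if_pos hc]; exact (hdomQ x hx p hp hpx).trans hc
      · simp only [hQ'def, if_neg hc, LinearIsometryEquiv.coe_refl, id_eq]; exact hidτ
  · -- the cubic sum
    have hpt : ∀ x ∈ W, σ' x ^ 3 ≤ t₀ * τp x ^ 2 + 12 * (if t₀ ≤ σ x then σ x ^ 2 else 0) := by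
      intro x _
      have h0 := hσ'0 x
      have hsqτ : σ' x ^ 2 ≤ τp x ^ 2 := pow_le_pow_left₀ h0 (hσ'τ x) 2
      have hsqσ : σ' x ^ 2 ≤ σ x ^ 2 := pow_le_pow_left₀ h0 (hσ'σ x) 2
      have hcube : σ' x ^ 3 = σ' x * σ' x ^ 2 := by ring
      by_cases ht : t₀ ≤ σ x
      · rw [if_pos ht, hcube]
        have h1 : σ' x * σ' x ^ 2 ≤ 12 * σ x ^ 2 := mul_le_mul (hσ'12 x) hsqσ (sq_nonneg _) (by norm_num)
        nlinarith [sq_nonneg (τp x), ht₀.le]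
      · rw [if_neg ht, mul_zero, add_zero, hcube]
        have hlt : σ' x ≤ t₀ := (hσ'σ x).trans (not_le.1 ht).le
        exact mul_le_mul hlt hsqτ (sq_nonneg _) ht₀.le
    -- the profile sum at scale `R + 4`
    have hτsum : ∑ᶠ x ∈ W, τp x ^ 2 ≤ 2 * Cg' * η * (winDensC δ ^ 2 * nK W) := by
      have h1 : ∑ᶠ x ∈ W, τp x ^ 2 ≤ ∑ᶠ x ∈ W4, τp x ^ 2 := finsum_mem_le_finsum_mem_of_subset_of_nonneg hW4fin hWW4 fun x _ => sq_nonneg _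
      have h2 : ∑ᶠ x ∈ W4, τp x ^ 2 = ∑ᶠ x ∈ W4, τ x ^ 2 := by
        refine finsum_mem_congr rfl fun x hx => ?_
        simp only [hτpdef, max_eq_left (henv x hx).1]
      have hRpos : 0 < R := by linarith
      have h3 : Cg' * ((R + 4) / R) * η ≤ 2 * Cg' * η := by
        have : (R + 4) / R ≤ 2 := by rw [div_le_iff₀ hRpos]; linarith
        have h' : Cg' * ((R + 4) / R) ≤ Cg' * 2 := mul_le_mul_of_nonneg_left this hCg'0.le
        nlinarith [hη.le]
      have hdens : nK W4 ≤ winDensC δ ^ 2 * nK W := nK_atomsIn_add_four_le haHi hδ hS.1 hR12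
      calc ∑ᶠ x ∈ W, τp x ^ 2 ≤ ∑ᶠ x ∈ W4, τ x ^ 2 := h1.trans_eq h2
        _ ≤ Cg' * ((R + 4) / R) * η * nK W4 := hgrad
        _ ≤ 2 * Cg' * η * nK W4 := mul_le_mul_of_nonneg_right h3 (nK_nonneg _)
        _ ≤ 2 * Cg' * η * (winDensC δ ^ 2 * nK W) := mul_le_mul_of_nonneg_left hdens (by positivity)
    have hmass' : ∑ᶠ x ∈ W, (if t₀ ≤ σ x then σ x ^ 2 else 0) ≤ ε / 24 * η * nK W := hmass
    have hnW := nK_nonneg W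
    calc ∑ᶠ x ∈ W, σ' x ^ 3 ≤ ∑ᶠ x ∈ W, (t₀ * τp x ^ 2 + 12 * (if t₀ ≤ σ x then σ x ^ 2 else 0)) := winsum_le_winsum_of_le hWfin hpt
      _ = t₀ * ∑ᶠ x ∈ W, τp x ^ 2 + 12 * ∑ᶠ x ∈ W, (if t₀ ≤ σ x then σ x ^ 2 else 0) := winsum_add_mul_eq hWfin _ _ _ _
      _ ≤ t₀ * (2 * Cg' * η * (winDensC δ ^ 2 * nK W)) + 12 * (ε / 24 * η * nK W) :=
          add_le_add (mul_le_mul_of_nonneg_left hτsum ht₀.le) (mul_le_mul_of_nonneg_left hmass' (by norm_num))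
      _ = (3 / 4 * ε) * η * nK W := by rw [ht₀def]; field_simp; ring
      _ ≤ ε * η * nK W := by
          have : 0 ≤ η * nK W := mul_nonneg hη.le hnW
          nlinarith

/-- ★ **(Mᵇ) ⟺ (M♭ᵇ)₀ (PROVED; `aHi ≤ 8/7`).** [this file, g52] -/
theorem strainNonConcentrationBPG_iff_strainSparseBPG_zero {aHi Λ θ s : ℝ} (haHi : aHi ≤ 8 / 7) :
    StrainNonConcentrationBPG aHi Λ θ s ↔ StrainSparseBPG 0 aHi Λ θ s :=
  ⟨fun h => strainSparseBPG_of_strainNonConcentrationBPG h 0, strainNonConcentrationBPG_of_strainSparseBPG haHi⟩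

/-! ### ZJ.2  [Cᵇ] «RigidCaccioppoliBPG» -/

/-- ★★★ **[Cᵇ] «RigidCaccioppoliBPG aHi Λ θ s»** — [C] `RigidCaccioppoliPG` (part UA) VERBATIM with the extra hypothesis `IsBondIso S Ψ` on the GIVEN
registration; conclusion unchanged (a re-registration `Ψ'` at `(Cg', η, R)` with tilt–strain data `(Q, σ)` on `win 8R` obeying (i) the `L²`-background bound
`Σ_{win 8R} σ² ≤ A·η·nK(win 8R)` and (ii) the weak reverse Hölder inequality with floor `A·η` on atom-centred balls whose double lies in `ball 0 (8R)`).
WEAKER than [C] (`rigidCaccioppoliBPG_of_rigidCaccioppoliPG`); with the Gehring leaf it gives (M♭ᵇ)₀ and (Mᵇ) (part UK: `strainSparseBPG_zero_of_rigidCaccioppoliBPG`,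
`strainNonConcentrationBPG_of_rigidCaccioppoliBPG`, part UB's proof); cut on the tame side in part UL (`[Cᵇ] ⟸ [Tᵇ] ∧ [C_Tᵇ]`).  MECHANISM · GSC-priced · UNDECIDED.
Why it might fail: as [C] minus the chart-side artefact — sparse isolated `O(1)` elastic misfits (defect-free strain concentrations) at density `≍ η` in a
BOND-ISOMORPHICALLY registered near-flat fat window would violate (ii) at intermediate scales; the relatively faulted charts that refute [C] as typed
(«ChartLamella») are excluded by the clause (h- and c-stars have non-isomorphic contact graphs).
Sources: part UA ([C]: Giaquinta–Modica 1979, [giaquinta1984 Ch. V §2]); parts TG, UI; Conway–Sloane, SPLAG Ch. 1 (the two 12-contact graphs). [this file, g52] -/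
def RigidCaccioppoliBPG (aHi Λ θ s : ℝ) : Prop :=
  ∀ δ : ℝ, 0 < δ → ∀ a : ℝ, 0 < a → ∀ Cg : ℝ, 1 ≤ Cg → ∃ Cg' : ℝ, Cg ≤ Cg' ∧
    ∃ b : ℝ, 0 < b ∧ ∃ d : ℝ, 0 < d ∧ d < 1 ∧ ∃ A : ℝ, 0 ≤ A ∧
    ∀ K₀ : ℝ, 0 < K₀ → ∃ η₁ : ℝ, 0 < η₁ ∧ ∃ R₁ : ℝ, 0 < R₁ ∧
      ∀ S : Set E3, IsDoorSetPG aHi δ S → (∀ q ∈ S, IsTwoShellAffineGood θ S q) →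
        ∀ η : ℝ, 0 < η → η ≤ η₁ → ∀ R : ℝ, R₁ ≤ R →
          ∀ (L : E3 ≃L[ℝ] E3) (w : ℤ → E3), IsEquilChart a s Λ L w →
            ∀ Ψ : E3 → E3, IsGlobalReg Cg η R S (LayeredHom (L : E3 →L[ℝ] E3) w) Ψ → IsBondIso S Ψ →
              K₀ ≤ η * nK (atomsIn (μS S) 0 R) →
                ∃ Ψ' : E3 → E3, IsGlobalReg Cg' η R S (LayeredHom (L : E3 →L[ℝ] E3) w) Ψ' ∧
                  ∃ (Q : E3 → (E3 ≃ₗᵢ[ℝ] E3)) (σ : E3 → ℝ), IsTiltStrainData S (8 * R) Ψ' Q σ ∧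
                    (∑ᶠ x ∈ atomsIn (μS S) 0 (8 * R), σ x ^ 2) ≤ A * η * nK (atomsIn (μS S) 0 (8 * R)) ∧
                    ∀ x ∈ S, ∀ r : ℝ, 0 < r → S ∩ ball x (2 * r) ⊆ ball 0 (8 * R) →
                      finavg (S ∩ ball x r) (fun y => σ y ^ 2) ≤
                        b * ((finavg (S ∩ ball x (2 * r)) (fun y => (σ y ^ 2) ^ d)) ^ (1 / d) + A * η)

/-- **[C] ⇒ [Cᵇ] (PROVED)** — one more hypothesis. [this file, g52] -/
theorem rigidCaccioppoliBPG_of_rigidCaccioppoliPG {aHi Λ θ s : ℝ} (h : RigidCaccioppoliPG aHi Λ θ s) : RigidCaccioppoliBPG aHi Λ θ s := by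
  intro δ hδ a ha Cg hCg
  obtain ⟨Cg', hCg', b, hb, d, hd0, hd1, A, hA, hK⟩ := h δ hδ a ha Cg hCg
  refine ⟨Cg', hCg', b, hb, d, hd0, hd1, A, hA, fun K₀ hK₀ => ?_⟩
  obtain ⟨η₁, hη₁, R₁, hR₁, h1⟩ := hK K₀ hK₀
  exact ⟨η₁, hη₁, R₁, hR₁, fun S hS hgood η hη hηle R hR L w hLw Ψ hΨ _ hfat => h1 S hS hgood η hη hηle R hR L w hLw Ψ hΨ hfat⟩

end Summit.AtomisticToContinuum.Crystallization.Theorems.ChartedZeroExcessLayeredLatticeLiouville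

end
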